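import Summits.HodgeConjecture.CorCM.IrreducibleOddWeightsRightIdealsFibreDefect
import Summits.HodgeConjecture.CorCM.IrreducibleOddWeightsRightIdealsGaloisPartner
import Literature.NumberTheory.ComplexMultiplication.SharedImaginaryQuadraticDegenerate
import Literature.NumberTheory.ComplexMultiplication.CMTypeCount
import HarnessLib

/-!
# Right ideals, X b: pigeonhole in `Anti(Hom(M, ℂ))` — for ANY Galois CM field `M` received by all the `K_i`,
# `Σ_i dim Hg(A_i) − dim Hg(∏_i A_i) ≥ Σ_i dim(w_iℚ[Gal(M/ℚ)]) − [M:ℚ]/2`, with no hypothesis on Galois closures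

COR-CM (cell `pub-hodgecm2`, binder seat `b16` gen 64, count-neutral claim RIGHT IDEALS, file R10b — CM-field dress of R10
`IrreducibleOddWeightsRightIdealsFibreDefect`; theorems only, no definition, no named fact, no `sorry`).  NEW as stated,
hence under `Summits/`.  HONEST FRAMING: hypothesis-free LOWER bounds for the codimension of `Hg(∏_i A_i)` in `∏_i Hg(A_i)`
(the exact formulas of R4–R9 need the gluing hypothesis (GL); the bounds here need nothing); `HC_CM` is neither used nor
asserted.

SETTING (R4–R7).  CM fields `K_i`, CM types `Φ_i`, a Galois CM field `M` with `j_i : M → K_i`, `z₀ : M → ℂ`; shadows `w_i`,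
Hecke modules `H_i = span{w_i(· ∘ δ) : δ ∈ Gal(M/ℚ)} = w_iℚ[Γ]` in `ℚ^{Hom(M,ℂ)}`, all inside the odd part `Anti(Hom(M, ℂ))`
(R7 `shadow_conjugate`), whose dimension is `[M:ℚ]/2`.

* §1 **`finrank_le_half_of_forall_apply_conjugate`** — a space of ODD functions on `Hom(M, ℂ)` (`f(z̄) = −f(z)`, `M` a CM
  field) has dimension `≤ [M:ℚ]/2` (restriction to a CM type of `M` is injective).
* §2 **`cmFamilyRank_add_card_add_sum_finrank_le`** — for ANY Galois `M` received by all `K_i`: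
  `cmFamilyRank Φ + |I| + Σ_i dim H_i ≤ Σ_i cmTypeRank Φ_i + 1 + dim Σ_i H_i`, i.e. **`Σ_i dim Hg(A_i) − dim Hg(∏_i A_i) ≥
  Σ_i dim(w_iℚ[Γ]) − dim(Σ_i w_iℚ[Γ])`** (R5b: equality under (GL)).
* §3 THE PIGEONHOLE: **`cmFamilyRank_add_card_add_sum_finrank_le_half`** — `M` a Galois CM field:
  **`Σ_i dim Hg(A_i) − dim Hg(∏_i A_i) ≥ Σ_i dim(w_iℚ[Γ]) − [M:ℚ]/2`**; pairs `cmFamilyRank_add_one_add_finrank_add_finrank_le`: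
  `dim Hg(A₀) + dim Hg(A₁) − dim Hg(A₀ × A₁) ≥ dim H₀ + dim H₁ − [M:ℚ]/2` — two shadows of large Hecke rank MUST collide;
  `cmFamilyRank_add_card_lt_of_half_lt_sum_finrank` — `Σ_i dim H_i > [M:ℚ]/2 ⟹ Hg(∏A_i) ⊊ ∏Hg(A_i)`.
* §4 **`cmFamilyRank_add_card_add_card_filter_le_of_finrank_eq_two`** — `M = k` imaginary quadratic:
  **`Σ_i dim Hg(A_i) − dim Hg(∏_i A_i) ≥ #{i : W_i ≠ 0} − 1`** with NO hypothesis on the closures (R7: `=` under (GL)) —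
  the tree's `SharedImaginaryQuadraticDegenerate` (two non-zero defects ⟹ `≥ 1`) for any number of members.

## References

* [Kubota1965] T. Kubota, *On the field extension by complex multiplication*, Trans. AMS 118 (1965), §2 Lemma 1, §4 Lemma 2.
* [Gordon1999HodgeAVSurvey] B. B. Gordon, *A survey of the Hodge conjecture for abelian varieties*, §3 Theorem (proof),
  7.5–7.7, 9.4.3.
* [Deligne1982HodgeCycles] P. Deligne, *Hodge cycles on abelian varieties*, LNM 900 (1982), I §5, §4 (Weil classes).
* [Shimura1998] G. Shimura, *Abelian Varieties with Complex Multiplication and Modular Functions*, §5.2 Thm. 1, §18.1.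
-/

set_option autoImplicit false

noncomputable section

open scoped BigOperators Classical

open CategoryTheory CategoryTheory.Limits NumberField NumberField.ComplexEmbedding Module IntermediateField

namespace Summit.HodgeConjecture.CorCM

open Literature.NumberTheory.ComplexMultiplication
open Literature.AlgebraicGeometry.Motives (AbelianVariety CMType)
open Literature.AlgebraicGeometry.Pohlmann1968

/-! ### §1 Odd functions on `Hom(M, ℂ)` form at most `[M:ℚ]/2` dimensions -/

section Odd

variable {M : Type} [Field M] [NumberField M] [IsCMField M]

/-- **Odd functions on `Hom(M, ℂ)` span at most `[M:ℚ]/2` dimensions**: restriction to a CM type `Ψ` of `M` (one embedding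
from each pair `{z, z̄}`) is injective on odd functions, and `|Ψ| = [M:ℚ]/2`.
[cite: Shimura1998, §5.2 Thm. 1 and §18.1] [cite: Kubota1965, §2 Lemma 1] -/
theorem finrank_le_half_of_forall_apply_conjugate (S : Submodule ℚ ((M →+* ℂ) → ℚ))
    (hS : ∀ f ∈ S, ∀ z, f (conjugate z) = -f z) : Module.finrank ℚ S ≤ finrank ℚ M / 2 := by
  obtain ⟨Ψ⟩ : Nonempty (CMType M) := CMTypeCount.nonempty_cmType_iff_isTotallyComplex.2 inferInstance
  let R : S →ₗ[ℚ] (↥Ψ.1 → ℚ) := (LinearMap.funLeft ℚ ℚ (Subtype.val : ↥Ψ.1 → (M →+* ℂ))) ∘ₗ S.subtype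
  have hR : ∀ (f : S) (t : ↥Ψ.1), R f t = (f : (M →+* ℂ) → ℚ) t.1 := fun f t => rfl
  have hinj : Function.Injective R := by
    intro f g hfg
    apply Subtype.ext
    funext z
    by_cases hz : z ∈ Ψ.1
    · have := congrFun hfg ⟨z, hz⟩
      rwa [hR, hR] at this
    · have hcz : conjugate z ∈ Ψ.1 := by
        by_contra hc
        exact hz ((Ψ.2 z).2 hc)
      have := congrFun hfg ⟨conjugate z, hcz⟩
      rw [hR, hR] at this
      change (f : (M →+* ℂ) → ℚ) (conjugate z) = (g : (M →+* ℂ) → ℚ) (conjugate z) at this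
      rw [hS f f.2 z, hS g g.2 z, neg_inj] at this
      exact this
  have h := LinearMap.finrank_le_finrank_of_injective hinj
  rw [Module.finrank_fintype_fun_eq_card, Fintype.card_subtype] at h
  have h2 := two_mul_card_filter_mem_cmType Ψ
  omega

end Odd

/-! ### §2 The unconditional family inequality over a Galois pivot -/

section Rank

variable {I : Type} [Fintype I] {K : I → Type} [∀ i, Field (K i)] [∀ i, NumberField (K i)] [∀ i, IsCMField (K i)]
  {M : Type} [Field M] [NumberField M]

/-- **`cmFamilyRank Φ + |I| + Σ_i dim H_i ≤ Σ_i cmTypeRank Φ_i + 1 + dim Σ_i H_i` for ANY Galois `M` received by all the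
`K_i`**: `Σ_i dim Hg(A_i) − dim Hg(∏_i A_i) ≥ Σ_i dim(w_iℚ[Γ]) − dim(Σ_i w_iℚ[Γ])` (R5b: equality under (GL)).
[cite: Kubota1965, §2 and §4 Lemma 2] [cite: Gordon1999HodgeAVSurvey, §3 Theorem (proof) and 7.5–7.7] -/
theorem cmFamilyRank_add_card_add_sum_finrank_le [IsGalois ℚ M] [Nonempty I] (Φ : ∀ i, CMType (K i))
    (j : ∀ i, M →+* K i) (z₀ : M →+* ℂ) :
    CMAlgebra.cmFamilyRank Φ + Fintype.card I +
        ∑ i, Module.finrank ℚ (Submodule.span ℚ (Set.range fun δ : M ≃ₐ[ℚ] M => fun z : M →+* ℂ =>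
          ∑ t ∈ Finset.univ.filter (fun t : K i →+* ℂ => t.comp (j i) = z.comp (δ : M →+* M)),
            antiVec (Φ i).1 (1 : ℂ ≃+* ℂ) t)) ≤
      (∑ i, cmTypeRank (Φ i)) + 1 +
        Module.finrank ℚ (⨆ i, Submodule.span ℚ (Set.range fun δ : M ≃ₐ[ℚ] M => fun z : M →+* ℂ =>
          ∑ t ∈ Finset.univ.filter (fun t : K i →+* ℂ => t.comp (j i) = z.comp (δ : M →+* M)),
            antiVec (Φ i).1 (1 : ℂ ≃+* ℂ) t) : Submodule ℚ ((M →+* ℂ) → ℚ)) := by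
  haveI : ∀ i, Nonempty (K i →+* ℂ) := fun i => inferInstance
  haveI := isPretransitive_ringEquiv_complex (K := M)
  exact IrrOdd.typeRank_sigmaType_add_card_add_sum_finrank_span_precomp_le (G := ℂ ≃+* ℂ) (E := fun i => K i →+* ℂ)
    (Φ := fun i => (Φ i).1) (fun i => isCMTypeWith_conj (Φ i)) (fun i (t : K i →+* ℂ) => t.comp (j i))
    (fun _ _ _ => RingHom.ext fun _ => rfl)
    (fun (δ : M ≃ₐ[ℚ] M) (z : M →+* ℂ) => z.comp (δ : M →+* M)) (fun _ _ _ => RingHom.ext fun _ => rfl) z₀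
    (fun z => exists_comp_algEquiv_eq z z₀) (fun z => MulAction.exists_smul_eq (ℂ ≃+* ℂ) z₀ z)

/-! ### §3 The pigeonhole in `Anti(Hom(M, ℂ))` -/

variable [IsCMField M]

omit [Fintype I] [∀ i, IsCMField (K i)] in
/-- The sum of the Hecke modules of the shadows has dimension `≤ [M:ℚ]/2` (they consist of odd functions).
[cite: Shimura1998, §18.1] [cite: Kubota1965, §2 Lemma 1] -/
theorem finrank_iSup_span_precomp_shadow_le_half (Φ : ∀ i, CMType (K i)) (j : ∀ i, M →+* K i) :
    Module.finrank ℚ (⨆ i, Submodule.span ℚ (Set.range fun δ : M ≃ₐ[ℚ] M => fun z : M →+* ℂ =>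
        ∑ t ∈ Finset.univ.filter (fun t : K i →+* ℂ => t.comp (j i) = z.comp (δ : M →+* M)),
          antiVec (Φ i).1 (1 : ℂ ≃+* ℂ) t) : Submodule ℚ ((M →+* ℂ) → ℚ)) ≤ finrank ℚ M / 2 :=
  finrank_le_half_of_forall_apply_conjugate _
    fun _ hf z => apply_conjugate_eq_neg_of_mem_iSup_span_precomp_shadow Φ j hf z

/-- **THE PIGEONHOLE: `Σ_i dim Hg(A_i) − dim Hg(∏_i A_i) ≥ Σ_i dim(w_iℚ[Γ]) − [M:ℚ]/2`** for ANY Galois CM field `M`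
received by all the `K_i` — `cmFamilyRank Φ + |I| + Σ_i dim H_i ≤ Σ_i cmTypeRank Φ_i + 1 + [M:ℚ]/2`.
[cite: Kubota1965, §2 and §4 Lemma 2] [cite: Gordon1999HodgeAVSurvey, §3 Theorem (proof), 7.5–7.7 and 9.4.3] -/
theorem cmFamilyRank_add_card_add_sum_finrank_le_half [IsGalois ℚ M] [Nonempty I] (Φ : ∀ i, CMType (K i))
    (j : ∀ i, M →+* K i) (z₀ : M →+* ℂ) :
    CMAlgebra.cmFamilyRank Φ + Fintype.card I +
        ∑ i, Module.finrank ℚ (Submodule.span ℚ (Set.range fun δ : M ≃ₐ[ℚ] M => fun z : M →+* ℂ =>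
          ∑ t ∈ Finset.univ.filter (fun t : K i →+* ℂ => t.comp (j i) = z.comp (δ : M →+* M)),
            antiVec (Φ i).1 (1 : ℂ ≃+* ℂ) t)) ≤
      (∑ i, cmTypeRank (Φ i)) + 1 + finrank ℚ M / 2 :=
  (cmFamilyRank_add_card_add_sum_finrank_le Φ j z₀).trans
    (Nat.add_le_add_left (finrank_iSup_span_precomp_shadow_le_half Φ j) _)

/-- **`Σ_i dim(w_iℚ[Γ]) > [M:ℚ]/2 ⟹ Hg(∏_i A_i) ⊊ ∏_i Hg(A_i)`** (strict drop `cmFamilyRank Φ + |I| < Σ_i cmTypeRank Φ_i + 1`).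
[cite: Kubota1965, §4 Lemma 2] [cite: Gordon1999HodgeAVSurvey, §3 Theorem (proof) and 7.5] -/
theorem cmFamilyRank_add_card_lt_of_half_lt_sum_finrank [IsGalois ℚ M] [Nonempty I] (Φ : ∀ i, CMType (K i))
    (j : ∀ i, M →+* K i) (z₀ : M →+* ℂ)
    (hbig : finrank ℚ M / 2 < ∑ i, Module.finrank ℚ (Submodule.span ℚ (Set.range fun δ : M ≃ₐ[ℚ] M =>
      fun z : M →+* ℂ => ∑ t ∈ Finset.univ.filter (fun t : K i →+* ℂ => t.comp (j i) = z.comp (δ : M →+* M)),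
        antiVec (Φ i).1 (1 : ℂ ≃+* ℂ) t))) :
    CMAlgebra.cmFamilyRank Φ + Fintype.card I < (∑ i, cmTypeRank (Φ i)) + 1 := by
  have h := cmFamilyRank_add_card_add_sum_finrank_le_half Φ j z₀
  omega

omit [Fintype I] in
/-- **PAIRS: `dim Hg(A₀) + dim Hg(A₁) − dim Hg(A₀ × A₁) ≥ dim H₀ + dim H₁ − [M:ℚ]/2`** — two shadows of large Hecke rank on
a common Galois CM subfield MUST collide (`I = {i₀, i₁}`, any Galois CM `M` received by both; no closure hypothesis).
[cite: Kubota1965, §2 and §4 Lemma 2] [cite: Gordon1999HodgeAVSurvey, §3 Theorem (proof) and 7.5–7.7] -/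
theorem cmFamilyRank_add_one_add_finrank_add_finrank_le [Fintype I] [IsGalois ℚ M] {i₀ i₁ : I} (h01 : i₀ ≠ i₁)
    (hI : ∀ l, l = i₀ ∨ l = i₁) (Φ : ∀ i, CMType (K i)) (j₀ : M →+* K i₀) (j₁ : M →+* K i₁) (z₀ : M →+* ℂ) :
    CMAlgebra.cmFamilyRank Φ + 1 +
        Module.finrank ℚ (Submodule.span ℚ (Set.range fun δ : M ≃ₐ[ℚ] M => fun z : M →+* ℂ =>
          ∑ t ∈ Finset.univ.filter (fun t : K i₀ →+* ℂ => t.comp j₀ = z.comp (δ : M →+* M)),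
            antiVec (Φ i₀).1 (1 : ℂ ≃+* ℂ) t)) +
        Module.finrank ℚ (Submodule.span ℚ (Set.range fun δ : M ≃ₐ[ℚ] M => fun z : M →+* ℂ =>
          ∑ t ∈ Finset.univ.filter (fun t : K i₁ →+* ℂ => t.comp j₁ = z.comp (δ : M →+* M)),
            antiVec (Φ i₁).1 (1 : ℂ ≃+* ℂ) t)) ≤
      cmTypeRank (Φ i₀) + cmTypeRank (Φ i₁) + finrank ℚ M / 2 := by
  -- the unconditional half of R4 plus `dim(H₀ ⊔ H₁) ≤ [M:ℚ]/2`
  have h1 := cmFamilyRank_add_one_add_finrank_inf_le h01 hI Φ j₀ j₁ z₀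
  have hsup := Submodule.finrank_sup_add_finrank_inf_eq
    (Submodule.span ℚ (Set.range fun δ : M ≃ₐ[ℚ] M => fun z : M →+* ℂ =>
      ∑ t ∈ Finset.univ.filter (fun t : K i₀ →+* ℂ => t.comp j₀ = z.comp (δ : M →+* M)), antiVec (Φ i₀).1 (1 : ℂ ≃+* ℂ) t))
    (Submodule.span ℚ (Set.range fun δ : M ≃ₐ[ℚ] M => fun z : M →+* ℂ =>
      ∑ t ∈ Finset.univ.filter (fun t : K i₁ →+* ℂ => t.comp j₁ = z.comp (δ : M →+* M)), antiVec (Φ i₁).1 (1 : ℂ ≃+* ℂ) t))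
  have hle : Module.finrank ℚ ↥(Submodule.span ℚ (Set.range fun δ : M ≃ₐ[ℚ] M => fun z : M →+* ℂ =>
      ∑ t ∈ Finset.univ.filter (fun t : K i₀ →+* ℂ => t.comp j₀ = z.comp (δ : M →+* M)), antiVec (Φ i₀).1 (1 : ℂ ≃+* ℂ) t) ⊔
      Submodule.span ℚ (Set.range fun δ : M ≃ₐ[ℚ] M => fun z : M →+* ℂ =>
      ∑ t ∈ Finset.univ.filter (fun t : K i₁ →+* ℂ => t.comp j₁ = z.comp (δ : M →+* M)), antiVec (Φ i₁).1 (1 : ℂ ≃+* ℂ) t))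
        ≤ finrank ℚ M / 2 := by
    refine finrank_le_half_of_forall_apply_conjugate _ fun f hf z => ?_
    obtain ⟨f₀, hf₀, f₁, hf₁, rfl⟩ := Submodule.mem_sup.1 hf
    rw [Pi.add_apply, Pi.add_apply, apply_conjugate_eq_neg_of_mem_span_precomp_shadow (Φ i₀) j₀ hf₀ z,
      apply_conjugate_eq_neg_of_mem_span_precomp_shadow (Φ i₁) j₁ hf₁ z, neg_add]
  omega

/-! ### §4 Imaginary quadratic pivot: `defect ≥ #{i : W_i ≠ 0} − 1`, unconditionally -/

/-- **`M = k` imaginary quadratic, NO hypothesis on the closures: `Σ_i dim Hg(A_i) − dim Hg(∏_i A_i) ≥ #{i : W_i ≠ 0} − 1`**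
(`cmFamilyRank Φ + |I| + #{i : W_i ≠ 0} ≤ Σ_i cmTypeRank Φ_i + 2`), `W_i = Σ_{t | t∘j_i = z₀} u_1(Φ_i)(t)` the signature defects
(R7: `=` under (GL)). [cite: Deligne1982HodgeCycles, §4] [cite: Gordon1999HodgeAVSurvey, 7.5–7.7 and 9.4.3] -/
theorem cmFamilyRank_add_card_add_card_filter_le_of_finrank_eq_two [Nonempty I] (hk : finrank ℚ M = 2)
    (Φ : ∀ i, CMType (K i)) (j : ∀ i, M →+* K i) (z₀ : M →+* ℂ) :
    CMAlgebra.cmFamilyRank Φ + Fintype.card I +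
        (Finset.univ.filter fun i => ∑ t ∈ Finset.univ.filter (fun t : K i →+* ℂ => t.comp (j i) = z₀),
          antiVec (Φ i).1 (1 : ℂ ≃+* ℂ) t ≠ 0).card ≤
      (∑ i, cmTypeRank (Φ i)) + 2 := by
  haveI := isGalois_of_finrank_eq_two hk
  have h := cmFamilyRank_add_card_add_sum_finrank_le_half Φ j z₀
  rw [Finset.sum_congr rfl fun i _ => finrank_span_precomp_shadow_eq hk (Φ i) (j i) z₀, Finset.sum_ite,
    Finset.sum_const_zero, zero_add, Finset.sum_const, smul_eq_mul, mul_one, hk] at h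
  convert h using 3

end Rank

end Summit.HodgeConjecture.CorCM

end
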